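import Literature.Probability.RandomPlanarGeometry.HexSAWStripSurfaceSideClassSummable
import Literature.Probability.RandomPlanarGeometry.HexSAWStripSurfaceSideToBridge
import Literature.Probability.RandomPlanarGeometry.HexSAWStripSurfaceThresholdExcess
import HarnessLib

/-!
# The side class of the DCS strip decays GEOMETRICALLY in the length on `0 < y ≤ y* = 1 + √2`:
# `E_{T,L+1}(x_c;y) ≤ (1 − x_c^{2T}(2 + √2 − y)) · E_{T,L}(x_c;y)`, hence `E_{T,L}(x_c;y) ≤ √2 · (1 − x_c^{2T}(2 + √2 − y))^L`,
# an identity at `T = 1`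

Topic `Literature/Probability/RandomPlanarGeometry` (lane «pcv-sawmu», a-p2 g14; combines the two increment inequalities of
`HexSAWStripSurfaceSideClassSummable.lean` (`HV.stripGFy_alpha_add_mul_eps_le_alpha_succ : A_{T,L} + x_c^{2T−1} E_{T,L} ≤ A_{T,L+1}`) and
`HexSAWStripSurfaceSideToBridge.lean` (`HV.stripGFy_beta_add_mul_eps_le_beta_succ : B_{T,L} + x_c^{2T} y E_{T,L} ≤ B_{T,L+1}`) with the
identity (16) of BBdGDCG14 in the tree's `y`-weighted form `HV.strip_identityY :
cos(3π/8) A_{T,L}(x_c;y) + ((1+√2−y)/(√2 y)) B_{T,L}(x_c;y) + cos(π/4) E_{T,L}(x_c;y) = 1` (`HexSAWStripIdentityY.lean`), and the surd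
facts `HV.cos_three_pi_div_eight_eq : cos(3π/8) = x_c/√2` (`HexSAWStripSurfaceThresholdExcess.lean`), `hexCriticalFugacity_sq :
x_c² (2+√2) = 1` (`HexSAW.lean`)).
Sources: N. R. Beaton, M. Bousquet-Mélou, J. de Gier, H. Duminil-Copin, A. J. Guttmann, Comm. Math. Phys. 326 (2014), arXiv:1109.0358v5:
§4.1 identity (16) (p. 13), proof of Proposition 9 (§4.3, p. 14: "`E_{T,L}(x_c; y)` … tends to `0` as `L → ∞`", no rate), §4.2 (p. 14:
the classes `A_{T,L}`, `B_{T,L}` increase with `L`); H. Duminil-Copin, S. Smirnov, Ann. of Math. 175 (2012), arXiv:1007.0575v2, §3 (at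
`y = 1`, v2 p. 6 after Lemma 2: "(E^{x_c}_{T,L})_{L>0} decreases and converges", from the same identity).

THE MECHANISM.  Subtracting the identity at `L` from the identity at `L + 1` and inserting the two increments (the coefficients
`cos(3π/8)` and `β(y) = (1+√2−y)/(√2 y) ≥ 0` are nonnegative exactly for `y ≤ y*`):
`cos(π/4) E_{T,L+1} = cos(π/4) E_{T,L} − cos(3π/8)(A_{T,L+1} − A_{T,L}) − β(y)(B_{T,L+1} − B_{T,L})
 ≤ (cos(π/4) − cos(3π/8) x_c^{2T−1} − β(y) x_c^{2T} y) E_{T,L}`, and `[cos(3π/8) x_c^{2T−1} + β(y) x_c^{2T} y]/cos(π/4) = x_c^{2T}(2 + √2 − y)`.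

## What is proved (namespace `Literature.Probability.RandomPlanarGeometry.SAW.HV`; `T ≥ 1`; standard axioms)

* `sideDecayRate T y := 1 − x_c^{2T} (2 + √2 − y)` — the one-step contraction factor; `sideDecayRate_nonneg` (`y ≥ 0`), `sideDecayRate_lt_one`
  (`y < 2 + √2`), ★ `sideDecayRate_one : sideDecayRate 1 y = x_c² y` (at `T = 1` the tree's `HexSAWStripSurfaceWidthOneProfile` has
  `E_{1,L}(x_c;y) = 2 (x_c² y)^{L+1}` — the contraction is EXACT), `sideDecayRate_yStar : sideDecayRate T (1+√2) = 1 − x_c^{2T}`.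
* ★★ `stripGFy_eps_succ_le_sideDecayRate_mul` — `E_{T,L+1}(x_c;y) ≤ sideDecayRate T y · E_{T,L}(x_c;y)` for `0 < y ≤ 1 + √2`;
  `stripGFy_eps_antitone` (the side class decreases in `L` there — DCS12's `y = 1` remark extended to `(0, y*]`).
* ★★ `stripGFy_eps_le_pow_mul`, `stripGFy_eps_le_sqrt_two_mul_pow` — `E_{T,L}(x_c;y) ≤ sideDecayRate^L · E_{T,0}(x_c;y) ≤ √2 · (1 − x_c^{2T}(2+√2−y))^L`:
  an EXPLICIT EXPONENTIAL RATE for the printed `E_{T,L} → 0`, on `(0, y*]`; `stripGFy_eps_yStar_le_pow` (`y = y*`: `≤ √2 (1 − x_c^{2T})^L`);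
  `sum_stripGFy_eps_le_geom`.
* ★★ GEOMETRIC CONVERGENCE OF THE CLASSES (identity (16) at two lengths, `strip_identityY_sub`): `stripGFy_alpha_sub_le`, `stripAyLim_sub_le` —
  `A_T(x_c;y) − A_{T,L}(x_c;y) ≤ E_{T,L}/x_c ≤ (√2/x_c)(1 − x_c^{2T}(2+√2−y))^L` on `0 < y ≤ y*` (incl. `y*`, where BBdGDCG §4.2 print "the
  limit exists and is finite"); `stripGFy_beta_sub_le`, `stripByLim_sub_le` — `B_T(x_c;y) − B_{T,L}(x_c;y) ≤ (y/(1+√2−y)) E_{T,L} ≤ (√2 y/(1+√2−y))(1 − …)^L`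
  on `0 < y < y*`.
* ★★★ THE CRITICAL ARCH IDENTITY FOR EVERY WIDTH, UNCONDITIONALLY: `one_sub_cos_mul_stripGFy_alpha_yStar_mem_Icc` —
  `0 ≤ 1 − cos(3π/8) A_{T,L}(x_c;y*) = cos(π/4) E_{T,L}(x_c;y*) ≤ (1 − x_c^{2T})^L`; hence `cos_mul_stripAyLim_yStar_eq_one'` /
  `cos_mul_stripAyLim_yStar_eq_one'` — `cos(3π/8) · A_T(x_c; y*) = 1` for every `T ≥ 1` (BGJ12-Ads eq. (4) "for any width T"; the corollary `A_T(x_c;y*) = A(x_c)` is the tree's `HV.stripAyLim_yStar`, EDITION 7 drops the local copy),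
  i.e. the tree's `cos_mul_stripAyLim_yStar_eq_one` (`HexSAWStripSurfaceCriticalArch`) with its hypothesis `y* < y_T` REMOVED, and the
  wide-strip squeeze of `HexSAWStripSurfaceCriticalArchLimit` (defect `δ_T ≤ B_{T−1}(x_c;1) → 0`) replaced by `δ_T = 0` at each `T`.
* In DCS12's own frame (`y = 1`): `stripAyLim_one` (`A_T(x_c;1) = HV.stripAlim T`), ★ `stripE_succ_le_mul`, ★★ `stripE_le_sqrt_two_mul_pow` —
  `E_{T,L}(x_c) ≤ √2 (1 − x_c^{2T}(1+√2))^L` (a rate for the tree's `stripElim_zero`), ★★ `stripAlim_sub_stripA_le` —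
  `A_T(x_c) − A_{T,L}(x_c) ≤ E_{T,L}(x_c)/x_c ≤ (√2/x_c)(1 − x_c^{2T}(1+√2))^L` (DCS prove monotone convergence, no rate).

Label: LANE THEOREM, NEW-IN-WRITING (modest, S): print has `E_{T,L}(x_c;y) → 0` for `y < y_T` without a rate (BBdGDCG14 Prop. 9), the
monotonicity in `L` at `y = 1` (DCS12) and the existence of the limits `A_T(x_c;y*)`, `B_T(x_c;y)` (§4.2) without rates; the geometric rates
with the explicit, `T`-explicit contraction `1 − x_c^{2T}(2+√2−y)` on the whole interval `(0, y*]`, exact at `T = 1`, are the lane's; the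
unconditional `cos(3π/8) A_T(x_c;y*) = 1` is a PRINTED statement (BGJ12-Ads eq. (4)) that the tree held only under `y* < y_T` or as `T → ∞` —
CONSOLIDATION BY A DIFFERENT (elementary) ROUTE.  NOT claimed: any rate on `(y*, y_T)` (there `β(y) < 0` and the bridge increment enters
with the wrong sign — summability still holds, `HexSAWStripSurfaceSideClassSummable`), optimality of the rate for `T ≥ 2`, numerics.
Lane «pcv-sawmu», a-p2 g14, 2026-08-24.  EDITIONS: ed.6 (a-p2 g15) = ed.5 (3dc1182c) code verbatim, the DCS12 §3 quotation in printed form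
(ref g55 §93.10 token DC-2; DC-1 needs nothing per lit-1 g21 16:34:59Z).
-/

noncomputable section

open Finset Filter Topology

namespace Literature.Probability.RandomPlanarGeometry.SAW.HV

variable {T L : ℕ} {y : ℝ}

/-! ### The contraction factor -/

/-- **The one-step contraction factor of the side class on `(0, y*]`**: `sideDecayRate T y = 1 − x_c^{2T} (2 + √2 − y)`.
[cite: BeatonBousquetMelouDeGierDuminilCopinGuttmann2014, §4.1 eq. (16) (arXiv v5 p. 13); lane: the explicit rate] -/
def sideDecayRate (T : ℕ) (y : ℝ) : ℝ := 1 - hexCriticalFugacity ^ (2 * T) * (2 + Real.sqrt 2 - y)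

/-- `sideDecayRate T y = 1 − x_c^{2T} (2 + √2 − y)`. [cite: BeatonBousquetMelouDeGierDuminilCopinGuttmann2014, §4.1 eq. (16); lane] -/
theorem sideDecayRate_def (T : ℕ) (y : ℝ) : sideDecayRate T y = 1 - hexCriticalFugacity ^ (2 * T) * (2 + Real.sqrt 2 - y) := rfl

/-- `0 ≤ sideDecayRate T y` for `T ≥ 1`, `y ≥ 0` (`x_c^{2T}(2 + √2 − y) ≤ x_c²(2 + √2) = 1`).
[cite: DuminilCopinSmirnov2012, §1 (x_c = 1/√(2+√2)); lane] -/
theorem sideDecayRate_nonneg (hT : 1 ≤ T) (hy : 0 ≤ y) : 0 ≤ sideDecayRate T y := by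
  obtain ⟨hx0, hx1⟩ := hexCriticalFugacity_pos_lt_one
  have hsq := hexCriticalFugacity_sq
  have hs : 0 ≤ Real.sqrt 2 := Real.sqrt_nonneg 2
  have hpow : hexCriticalFugacity ^ (2 * T) ≤ hexCriticalFugacity ^ 2 := pow_le_pow_of_le_one hx0.le hx1.le (by omega)
  have h1 : hexCriticalFugacity ^ (2 * T) * (2 + Real.sqrt 2 - y) ≤ hexCriticalFugacity ^ 2 * (2 + Real.sqrt 2) := by
    calc hexCriticalFugacity ^ (2 * T) * (2 + Real.sqrt 2 - y) ≤ hexCriticalFugacity ^ (2 * T) * (2 + Real.sqrt 2) :=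
          mul_le_mul_of_nonneg_left (by linarith) (pow_nonneg hx0.le _)
      _ ≤ hexCriticalFugacity ^ 2 * (2 + Real.sqrt 2) := mul_le_mul_of_nonneg_right hpow (by positivity)
  rw [sideDecayRate]
  linarith

/-- `sideDecayRate T y < 1` for `y < 2 + √2`. [cite: BeatonBousquetMelouDeGierDuminilCopinGuttmann2014, §4.1 eq. (16); lane] -/
theorem sideDecayRate_lt_one (T : ℕ) (hy : y < 2 + Real.sqrt 2) : sideDecayRate T y < 1 := by
  have hx := pow_pos hexCriticalFugacity_pos_lt_one.1 (2 * T)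
  rw [sideDecayRate]
  nlinarith [mul_pos hx (sub_pos.2 hy)]

/-- ★ **At width one the contraction factor is `x_c² y`** — and the tree's closed form `E_{1,L}(x_c;y) = 2 (x_c² y)^{L+1}`
(`HexSAWStripSurfaceWidthOneProfile`) shows the one-step inequality below is then an IDENTITY. [cite: DuminilCopinSmirnov2012, §1 (x_c² (2+√2) = 1); lane] -/
theorem sideDecayRate_one (y : ℝ) : sideDecayRate 1 y = hexCriticalFugacity ^ 2 * y := by
  have hsq := hexCriticalFugacity_sq
  rw [sideDecayRate, show 2 * 1 = 2 from rfl]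
  linear_combination (-1 : ℝ) * hsq

/-- At the critical surface fugacity `y* = 1 + √2`: `sideDecayRate T y* = 1 − x_c^{2T}`. [cite: BeatonBousquetMelouDeGierDuminilCopinGuttmann2014, §4.2 (arXiv v5 p. 14: y = y*); lane] -/
theorem sideDecayRate_yStar (T : ℕ) : sideDecayRate T (1 + Real.sqrt 2) = 1 - hexCriticalFugacity ^ (2 * T) := by
  rw [sideDecayRate]; ring

/-- The algebra of the coefficients: `[cos(3π/8) x_c^{2T−1} + ((1+√2−y)/(√2 y)) x_c^{2T} y] / cos(π/4) = x_c^{2T} (2 + √2 − y)`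
(`T ≥ 1`, `y ≠ 0`; `cos(3π/8) = x_c/√2`, `cos(π/4) = √2/2`). [cite: DuminilCopinSmirnov2012, §2 (the weights); lane] -/
theorem coeff_div_cos_pi_div_four_eq (hT : 1 ≤ T) (hy : y ≠ 0) :
    (Real.cos (3 * Real.pi / 8) * hexCriticalFugacity ^ (2 * T - 1) +
        (1 + Real.sqrt 2 - y) / (Real.sqrt 2 * y) * (hexCriticalFugacity ^ (2 * T) * y)) / Real.cos (Real.pi / 4) =
      hexCriticalFugacity ^ (2 * T) * (2 + Real.sqrt 2 - y) := by
  have hs : (0 : ℝ) < Real.sqrt 2 := by positivity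
  have hs2 : Real.sqrt 2 * Real.sqrt 2 = 2 := Real.mul_self_sqrt (by norm_num)
  have hpow : hexCriticalFugacity ^ (2 * T) = hexCriticalFugacity * hexCriticalFugacity ^ (2 * T - 1) := by
    rw [← pow_succ', Nat.sub_add_cancel (by omega)]
  have hc : (0 : ℝ) < Real.sqrt 2 / 2 := by positivity
  have h1 : hexCriticalFugacity / Real.sqrt 2 * hexCriticalFugacity ^ (2 * T - 1) = hexCriticalFugacity ^ (2 * T) / Real.sqrt 2 := by
    rw [hpow]; ring
  have h2 : (1 + Real.sqrt 2 - y) / (Real.sqrt 2 * y) * (hexCriticalFugacity ^ (2 * T) * y) =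
      (1 + Real.sqrt 2 - y) * hexCriticalFugacity ^ (2 * T) / Real.sqrt 2 := by
    field_simp
  have h3 : Real.sqrt 2 / 2 * Real.sqrt 2 = 1 := by rw [div_mul_eq_mul_div, hs2]; norm_num
  rw [cos_three_pi_div_eight_eq, Real.cos_pi_div_four, div_eq_iff hc.ne', h1, h2, ← add_div, div_eq_iff hs.ne']
  calc hexCriticalFugacity ^ (2 * T) + (1 + Real.sqrt 2 - y) * hexCriticalFugacity ^ (2 * T)
      = hexCriticalFugacity ^ (2 * T) * (2 + Real.sqrt 2 - y) * 1 := by ring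
    _ = hexCriticalFugacity ^ (2 * T) * (2 + Real.sqrt 2 - y) * (Real.sqrt 2 / 2 * Real.sqrt 2) := by rw [h3]
    _ = hexCriticalFugacity ^ (2 * T) * (2 + Real.sqrt 2 - y) * (Real.sqrt 2 / 2) * Real.sqrt 2 := by ring

/-! ### The one-step contraction -/

/-- The raw one-step inequality from identity (16) at `L` and `L + 1` and the two increments (`0 < y ≤ 1 + √2`):
`cos(π/4) E_{T,L+1} ≤ (cos(π/4) − cos(3π/8) x_c^{2T−1} − β(y) x_c^{2T} y) E_{T,L}`.
[cite: BeatonBousquetMelouDeGierDuminilCopinGuttmann2014, §4.1 eq. (16) (arXiv v5 p. 13) and §4.2 (p. 14); DuminilCopinSmirnov2012, §3 (arXiv v2 p. 6: "(E^{x_c}_{T,L})_{L>0} decreases and converges", at y = 1); lane] -/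
theorem cos_mul_stripGFy_eps_succ_le (hT : 1 ≤ T) (hy : 0 < y) (hle : y ≤ 1 + Real.sqrt 2) (L : ℕ) :
    Real.cos (Real.pi / 4) * stripGFy T (L + 1) (IsEpsDart (L + 1)) y ≤
      (Real.cos (Real.pi / 4) - (Real.cos (3 * Real.pi / 8) * hexCriticalFugacity ^ (2 * T - 1) +
          (1 + Real.sqrt 2 - y) / (Real.sqrt 2 * y) * (hexCriticalFugacity ^ (2 * T) * y))) *
        stripGFy T L (IsEpsDart L) y := by
  have hid0 := strip_identityY (L := L) hT hy
  have hid1 := strip_identityY (L := L + 1) hT hy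
  have hA := stripGFy_alpha_add_mul_eps_le_alpha_succ hT L hy.le
  have hB := stripGFy_beta_add_mul_eps_le_beta_succ hT L hy.le
  have hcα : 0 ≤ Real.cos (3 * Real.pi / 8) := cos_three_pi_div_eight_pos.le
  have hβ : 0 ≤ (1 + Real.sqrt 2 - y) / (Real.sqrt 2 * y) := div_nonneg (by linarith) (by positivity)
  have h1 := mul_le_mul_of_nonneg_left hA hcα
  have h2 := mul_le_mul_of_nonneg_left hB hβ
  nlinarith [h1, h2]

/-- ★★ **`E_{T,L+1}(x_c;y) ≤ sideDecayRate T y · E_{T,L}(x_c;y)`** for `T ≥ 1`, `0 < y ≤ 1 + √2`, every `L`.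
[cite: BeatonBousquetMelouDeGierDuminilCopinGuttmann2014, proof of Proposition 9 (§4.3, arXiv v5 p. 14: "E_{T,L}(x_c; y) … tends to 0") and §4.1 eq. (16); lane: explicit geometric rate] -/
theorem stripGFy_eps_succ_le_sideDecayRate_mul (hT : 1 ≤ T) (hy : 0 < y) (hle : y ≤ 1 + Real.sqrt 2) (L : ℕ) :
    stripGFy T (L + 1) (IsEpsDart (L + 1)) y ≤ sideDecayRate T y * stripGFy T L (IsEpsDart L) y := by
  have hc : 0 < Real.cos (Real.pi / 4) := cos_pi_div_four_pos'
  have h := cos_mul_stripGFy_eps_succ_le hT hy hle L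
  have hE : 0 ≤ stripGFy T L (IsEpsDart L) y := stripGFy_nonneg' T L (IsEpsDart L) hy.le
  have hθ : sideDecayRate T y =
      (Real.cos (Real.pi / 4) - (Real.cos (3 * Real.pi / 8) * hexCriticalFugacity ^ (2 * T - 1) +
          (1 + Real.sqrt 2 - y) / (Real.sqrt 2 * y) * (hexCriticalFugacity ^ (2 * T) * y))) / Real.cos (Real.pi / 4) := by
    rw [sub_div, div_self hc.ne', coeff_div_cos_pi_div_four_eq hT hy.ne', sideDecayRate]
  rw [hθ, div_mul_eq_mul_div, le_div_iff₀ hc, mul_comm]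
  exact h

/-- **On `(0, y*]` the side class decreases in `L`** (DCS12's `y = 1` remark, extended). [cite: DuminilCopinSmirnov2012, §3 (arXiv v2 p. 6: "(E^{x_c}_{T,L})_{L>0} decreases and converges"); BeatonBousquetMelouDeGierDuminilCopinGuttmann2014, §4.2 (arXiv v5 p. 14)] -/
theorem stripGFy_eps_antitone (hT : 1 ≤ T) (hy : 0 < y) (hle : y ≤ 1 + Real.sqrt 2) :
    Antitone (fun L => stripGFy T L (IsEpsDart L) y) := by
  refine antitone_nat_of_succ_le fun L => ?_
  have h := stripGFy_eps_succ_le_sideDecayRate_mul hT hy hle L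
  have hθ : sideDecayRate T y ≤ 1 := (sideDecayRate_lt_one T (by linarith [Real.sqrt_nonneg 2])).le
  have hE : 0 ≤ stripGFy T L (IsEpsDart L) y := stripGFy_nonneg' T L (IsEpsDart L) hy.le
  nlinarith

/-! ### The geometric bound -/

/-- ★★ **`E_{T,L}(x_c;y) ≤ (sideDecayRate T y)^L · E_{T,0}(x_c;y)`** (`T ≥ 1`, `0 < y ≤ 1 + √2`).
[cite: BeatonBousquetMelouDeGierDuminilCopinGuttmann2014, proof of Proposition 9 (§4.3, arXiv v5 p. 14); lane: geometric rate] -/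
theorem stripGFy_eps_le_pow_mul (hT : 1 ≤ T) (hy : 0 < y) (hle : y ≤ 1 + Real.sqrt 2) (L : ℕ) :
    stripGFy T L (IsEpsDart L) y ≤ sideDecayRate T y ^ L * stripGFy T 0 (IsEpsDart 0) y := by
  have hθ0 : 0 ≤ sideDecayRate T y := sideDecayRate_nonneg hT hy.le
  induction L with
  | zero => simp
  | succ L ih =>
    calc stripGFy T (L + 1) (IsEpsDart (L + 1)) y ≤ sideDecayRate T y * stripGFy T L (IsEpsDart L) y :=
          stripGFy_eps_succ_le_sideDecayRate_mul hT hy hle L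
      _ ≤ sideDecayRate T y * (sideDecayRate T y ^ L * stripGFy T 0 (IsEpsDart 0) y) := mul_le_mul_of_nonneg_left ih hθ0
      _ = sideDecayRate T y ^ (L + 1) * stripGFy T 0 (IsEpsDart 0) y := by rw [pow_succ]; ring

/-- The initial value: `E_{T,0}(x_c;y) ≤ 1/cos(π/4) = √2` for `0 < y ≤ 1 + √2` (identity (16) with nonnegative other terms).
[cite: BeatonBousquetMelouDeGierDuminilCopinGuttmann2014, §4.1 eq. (16) (arXiv v5 p. 13)] -/
theorem stripGFy_eps_le_sqrt_two (hT : 1 ≤ T) (hy : 0 < y) (hle : y ≤ 1 + Real.sqrt 2) (L : ℕ) :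
    stripGFy T L (IsEpsDart L) y ≤ Real.sqrt 2 := by
  have hid := strip_identityY (L := L) hT hy
  have hA := stripGFy_nonneg' T L IsAlphaDart hy.le
  have hB := stripGFy_nonneg' T L (IsBetaDart T) hy.le
  have hcα : 0 ≤ Real.cos (3 * Real.pi / 8) := cos_three_pi_div_eight_pos.le
  have hβ : 0 ≤ (1 + Real.sqrt 2 - y) / (Real.sqrt 2 * y) := div_nonneg (by linarith) (by positivity)
  have hc : Real.cos (Real.pi / 4) = Real.sqrt 2 / 2 := Real.cos_pi_div_four
  have hs2 : Real.sqrt 2 * Real.sqrt 2 = 2 := Real.mul_self_sqrt (by norm_num)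
  rw [hc] at hid
  nlinarith [mul_nonneg hcα hA, mul_nonneg hβ hB, Real.sqrt_nonneg 2]

/-- ★★ **`E_{T,L}(x_c;y) ≤ √2 · (1 − x_c^{2T}(2 + √2 − y))^L`** for `T ≥ 1`, `0 < y ≤ 1 + √2`: an explicit exponential rate for the
printed `E_{T,L}(x_c;y) → 0`. [cite: BeatonBousquetMelouDeGierDuminilCopinGuttmann2014, proof of Proposition 9 (§4.3, arXiv v5 p. 14: no rate printed); lane: NEW rate] -/
theorem stripGFy_eps_le_sqrt_two_mul_pow (hT : 1 ≤ T) (hy : 0 < y) (hle : y ≤ 1 + Real.sqrt 2) (L : ℕ) :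
    stripGFy T L (IsEpsDart L) y ≤ Real.sqrt 2 * (1 - hexCriticalFugacity ^ (2 * T) * (2 + Real.sqrt 2 - y)) ^ L := by
  have h1 := stripGFy_eps_le_pow_mul hT hy hle L
  have h2 := stripGFy_eps_le_sqrt_two hT hy hle 0
  have hθ : 0 ≤ sideDecayRate T y ^ L := pow_nonneg (sideDecayRate_nonneg hT hy.le) L
  calc stripGFy T L (IsEpsDart L) y ≤ sideDecayRate T y ^ L * stripGFy T 0 (IsEpsDart 0) y := h1
    _ ≤ sideDecayRate T y ^ L * Real.sqrt 2 := mul_le_mul_of_nonneg_left h2 hθ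
    _ = Real.sqrt 2 * (1 - hexCriticalFugacity ^ (2 * T) * (2 + Real.sqrt 2 - y)) ^ L := by rw [sideDecayRate, mul_comm]

/-- **At `y = y*`: `E_{T,L}(x_c; y*) ≤ √2 · (1 − x_c^{2T})^L`.** [cite: BeatonBousquetMelouDeGierDuminilCopinGuttmann2014, §4.2 (arXiv v5 p. 14: y = y*); lane] -/
theorem stripGFy_eps_yStar_le_pow (hT : 1 ≤ T) (L : ℕ) :
    stripGFy T L (IsEpsDart L) yStar ≤ Real.sqrt 2 * (1 - hexCriticalFugacity ^ (2 * T)) ^ L := by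
  have h := stripGFy_eps_le_sqrt_two_mul_pow hT yStar_pos (le_of_eq rfl) L
  have e : (2 : ℝ) + Real.sqrt 2 - yStar = 1 := by unfold yStar; ring
  rwa [e, mul_one] at h

/-- The geometric series bound that follows: `Σ_{L<N} E_{T,L}(x_c;y) ≤ √2 / (x_c^{2T}(2 + √2 − y))` for `0 < y ≤ 1 + √2` (a second route to the
summability of `HexSAWStripSurfaceSideClassSummable`, with a different constant). [cite: BeatonBousquetMelouDeGierDuminilCopinGuttmann2014, proof of Proposition 9 (§4.3, arXiv v5 p. 14); lane] -/
theorem sum_stripGFy_eps_le_geom (hT : 1 ≤ T) (hy : 0 < y) (hle : y ≤ 1 + Real.sqrt 2) (N : ℕ) :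
    ∑ L ∈ Finset.range N, stripGFy T L (IsEpsDart L) y ≤
      Real.sqrt 2 / (hexCriticalFugacity ^ (2 * T) * (2 + Real.sqrt 2 - y)) := by
  have hθ0 : 0 ≤ sideDecayRate T y := sideDecayRate_nonneg hT hy.le
  have hθ1 : sideDecayRate T y < 1 := sideDecayRate_lt_one T (by linarith [Real.sqrt_nonneg 2])
  have hs : 0 ≤ Real.sqrt 2 := Real.sqrt_nonneg 2
  have hgeom : ∑ L ∈ Finset.range N, sideDecayRate T y ^ L ≤ 1 / (1 - sideDecayRate T y) := by
    have h := geom_sum_Ico_le_of_lt_one (m := 0) (n := N) hθ0 hθ1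
    rwa [pow_zero, ← Finset.range_eq_Ico] at h
  have h1 : 1 - sideDecayRate T y = hexCriticalFugacity ^ (2 * T) * (2 + Real.sqrt 2 - y) := by rw [sideDecayRate]; ring
  calc ∑ L ∈ Finset.range N, stripGFy T L (IsEpsDart L) y
      ≤ ∑ L ∈ Finset.range N, Real.sqrt 2 * sideDecayRate T y ^ L :=
        sum_le_sum fun L _ => stripGFy_eps_le_sqrt_two_mul_pow hT hy hle L
    _ = Real.sqrt 2 * ∑ L ∈ Finset.range N, sideDecayRate T y ^ L := by rw [mul_sum]
    _ ≤ Real.sqrt 2 * (1 / (1 - sideDecayRate T y)) := mul_le_mul_of_nonneg_left hgeom hs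
    _ = Real.sqrt 2 / (hexCriticalFugacity ^ (2 * T) * (2 + Real.sqrt 2 - y)) := by rw [h1, mul_one_div]


/-! ### Geometric convergence of the arch and bridge classes to their limits on `(0, y*]` -/

/-- Identity (16) at two lengths: `cos(3π/8)(A_{T,L'} − A_{T,L}) + β(y)(B_{T,L'} − B_{T,L}) = cos(π/4)(E_{T,L} − E_{T,L'})`
(`β(y) = (1+√2−y)/(√2 y)`). [cite: BeatonBousquetMelouDeGierDuminilCopinGuttmann2014, §4.1 eq. (16) (arXiv v5 p. 13)] -/
theorem strip_identityY_sub (hT : 1 ≤ T) (hy : 0 < y) (L L' : ℕ) :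
    Real.cos (3 * Real.pi / 8) * (stripGFy T L' IsAlphaDart y - stripGFy T L IsAlphaDart y) +
        (1 + Real.sqrt 2 - y) / (Real.sqrt 2 * y) * (stripGFy T L' (IsBetaDart T) y - stripGFy T L (IsBetaDart T) y) =
      Real.cos (Real.pi / 4) * (stripGFy T L (IsEpsDart L) y - stripGFy T L' (IsEpsDart L') y) := by
  have h0 := strip_identityY (L := L) hT hy
  have h1 := strip_identityY (L := L') hT hy
  linear_combination h1 - h0

/-- `cos(π/4)/cos(3π/8) = 1/x_c`. [cite: DuminilCopinSmirnov2012, §2 (the weights); lane] -/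
theorem cos_pi_div_four_div_cos_three_pi_div_eight : Real.cos (Real.pi / 4) / Real.cos (3 * Real.pi / 8) = hexCriticalFugacity⁻¹ := by
  have hs : (0 : ℝ) < Real.sqrt 2 := by positivity
  have hs2 : Real.sqrt 2 * Real.sqrt 2 = 2 := Real.mul_self_sqrt (by norm_num)
  have hx : 0 < hexCriticalFugacity := hexCriticalFugacity_pos_lt_one.1
  rw [cos_three_pi_div_eight_eq, Real.cos_pi_div_four]
  field_simp
  linarith [hs2]

/-- ★ **The arch class is within `E_{T,L}/x_c` of every later value**: `A_{T,L'}(x_c;y) − A_{T,L}(x_c;y) ≤ x_c⁻¹ · E_{T,L}(x_c;y)` for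
`L ≤ L'`, `0 < y ≤ 1 + √2`. [cite: BeatonBousquetMelouDeGierDuminilCopinGuttmann2014, §4.2 (arXiv v5 p. 14: "the limit … exists"); lane: explicit tail] -/
theorem stripGFy_alpha_sub_le (hT : 1 ≤ T) (hy : 0 < y) (hle : y ≤ 1 + Real.sqrt 2) {L' : ℕ} (hLL' : L ≤ L') :
    stripGFy T L' IsAlphaDart y - stripGFy T L IsAlphaDart y ≤ hexCriticalFugacity⁻¹ * stripGFy T L (IsEpsDart L) y := by
  have hid := strip_identityY_sub hT hy L L'
  have hcα : 0 < Real.cos (3 * Real.pi / 8) := cos_three_pi_div_eight_pos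
  have hβ : 0 ≤ (1 + Real.sqrt 2 - y) / (Real.sqrt 2 * y) := div_nonneg (by linarith) (by positivity)
  have hB : 0 ≤ stripGFy T L' (IsBetaDart T) y - stripGFy T L (IsBetaDart T) y := sub_nonneg.2 (stripGFy_beta_mono_L hLL' hy.le)
  have hE' : 0 ≤ stripGFy T L' (IsEpsDart L') y := stripGFy_nonneg' T L' (IsEpsDart L') hy.le
  have h1 : Real.cos (3 * Real.pi / 8) * (stripGFy T L' IsAlphaDart y - stripGFy T L IsAlphaDart y) ≤
      Real.cos (Real.pi / 4) * stripGFy T L (IsEpsDart L) y := by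
    nlinarith [mul_nonneg hβ hB, mul_nonneg (cos_pi_div_four_pos').le hE']
  rw [← cos_pi_div_four_div_cos_three_pi_div_eight, div_mul_eq_mul_div, le_div_iff₀ hcα]
  linarith

/-- ★★ **Geometric convergence of the arch class**: `A_T(x_c;y) − A_{T,L}(x_c;y) ≤ x_c⁻¹ · E_{T,L}(x_c;y) ≤ (√2/x_c) · (1 − x_c^{2T}(2+√2−y))^L`
for `0 < y ≤ 1 + √2` (`A_T = sup_L A_{T,L}` = `HV.stripAyLim`). [cite: BeatonBousquetMelouDeGierDuminilCopinGuttmann2014, §4.2 (arXiv v5 p. 14: "Hence the limit lim_{L→∞} A_{T,L}(x_c; y*) exists and is finite" — no rate printed); lane: explicit geometric rate] -/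
theorem stripAyLim_sub_le (hT : 1 ≤ T) (hy : 0 < y) (hle : y ≤ 1 + Real.sqrt 2) (L : ℕ) :
    stripAyLim T y - stripGFy T L IsAlphaDart y ≤ hexCriticalFugacity⁻¹ * stripGFy T L (IsEpsDart L) y ∧
      stripAyLim T y - stripGFy T L IsAlphaDart y ≤
        Real.sqrt 2 / hexCriticalFugacity * (1 - hexCriticalFugacity ^ (2 * T) * (2 + Real.sqrt 2 - y)) ^ L := by
  have hx : 0 < hexCriticalFugacity := hexCriticalFugacity_pos_lt_one.1
  have h1 : stripAyLim T y - stripGFy T L IsAlphaDart y ≤ hexCriticalFugacity⁻¹ * stripGFy T L (IsEpsDart L) y := by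
    rw [sub_le_iff_le_add]
    refine ciSup_le fun L' => ?_
    rcases le_total L L' with h | h
    · linarith [stripGFy_alpha_sub_le hT hy hle h]
    · have := stripGFy_alpha_mono_L (T := T) h hy.le
      have hE : 0 ≤ hexCriticalFugacity⁻¹ * stripGFy T L (IsEpsDart L) y :=
        mul_nonneg (inv_nonneg.2 hx.le) (stripGFy_nonneg' T L (IsEpsDart L) hy.le)
      linarith
  refine ⟨h1, h1.trans ?_⟩
  have h2 := stripGFy_eps_le_sqrt_two_mul_pow hT hy hle L
  calc hexCriticalFugacity⁻¹ * stripGFy T L (IsEpsDart L) y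
      ≤ hexCriticalFugacity⁻¹ * (Real.sqrt 2 * (1 - hexCriticalFugacity ^ (2 * T) * (2 + Real.sqrt 2 - y)) ^ L) :=
        mul_le_mul_of_nonneg_left h2 (inv_nonneg.2 hx.le)
    _ = Real.sqrt 2 / hexCriticalFugacity * (1 - hexCriticalFugacity ^ (2 * T) * (2 + Real.sqrt 2 - y)) ^ L := by ring

/-- ★ **The bridge class is within `(y/(1+√2−y)) · E_{T,L}` of every later value** for `0 < y < 1 + √2`, `L ≤ L'`
(`cos(π/4)/β(y) = y/(1+√2−y)`). [cite: BeatonBousquetMelouDeGierDuminilCopinGuttmann2014, §4.2 (arXiv v5 p. 14); lane: explicit tail] -/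
theorem stripGFy_beta_sub_le (hT : 1 ≤ T) (hy : 0 < y) (hlt : y < 1 + Real.sqrt 2) {L' : ℕ} (hLL' : L ≤ L') :
    stripGFy T L' (IsBetaDart T) y - stripGFy T L (IsBetaDart T) y ≤ y / (1 + Real.sqrt 2 - y) * stripGFy T L (IsEpsDart L) y := by
  have hid := strip_identityY_sub hT hy L L'
  have hs : (0 : ℝ) < Real.sqrt 2 := by positivity
  have hs2 : Real.sqrt 2 * Real.sqrt 2 = 2 := Real.mul_self_sqrt (by norm_num)
  have hgap : 0 < 1 + Real.sqrt 2 - y := sub_pos.2 hlt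
  have hβ : 0 < (1 + Real.sqrt 2 - y) / (Real.sqrt 2 * y) := div_pos hgap (by positivity)
  have hA : 0 ≤ stripGFy T L' IsAlphaDart y - stripGFy T L IsAlphaDart y := sub_nonneg.2 (stripGFy_alpha_mono_L hLL' hy.le)
  have hE' : 0 ≤ stripGFy T L' (IsEpsDart L') y := stripGFy_nonneg' T L' (IsEpsDart L') hy.le
  have h1 : (1 + Real.sqrt 2 - y) / (Real.sqrt 2 * y) * (stripGFy T L' (IsBetaDart T) y - stripGFy T L (IsBetaDart T) y) ≤
      Real.cos (Real.pi / 4) * stripGFy T L (IsEpsDart L) y := by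
    nlinarith [mul_nonneg cos_three_pi_div_eight_pos.le hA, mul_nonneg (cos_pi_div_four_pos').le hE']
  have hratio : Real.cos (Real.pi / 4) / ((1 + Real.sqrt 2 - y) / (Real.sqrt 2 * y)) = y / (1 + Real.sqrt 2 - y) := by
    rw [Real.cos_pi_div_four]
    field_simp
    linarith [hs2]
  rw [← hratio, div_mul_eq_mul_div, le_div_iff₀ hβ]
  linarith

/-- ★★ **Geometric convergence of the bridge class**: `B_T(x_c;y) − B_{T,L}(x_c;y) ≤ (y/(1+√2−y)) · E_{T,L}(x_c;y) ≤ (√2 y/(1+√2−y)) · (1 − x_c^{2T}(2+√2−y))^L`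
for `0 < y < 1 + √2` (`B_T = sup_L B_{T,L}` = `HV.stripByLim`). [cite: BeatonBousquetMelouDeGierDuminilCopinGuttmann2014, Proposition 9 (arXiv v5 p. 14 l. 16: "y_T (the radius of convergence of A_T(x_c,·) and B_T(x_c,·))") and Corollary 8 (p. 12) — no rate printed; lane: explicit geometric rate] -/
theorem stripByLim_sub_le (hT : 1 ≤ T) (hy : 0 < y) (hlt : y < 1 + Real.sqrt 2) (L : ℕ) :
    stripByLim T y - stripGFy T L (IsBetaDart T) y ≤ y / (1 + Real.sqrt 2 - y) * stripGFy T L (IsEpsDart L) y ∧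
      stripByLim T y - stripGFy T L (IsBetaDart T) y ≤
        Real.sqrt 2 * y / (1 + Real.sqrt 2 - y) * (1 - hexCriticalFugacity ^ (2 * T) * (2 + Real.sqrt 2 - y)) ^ L := by
  have hgap : 0 < 1 + Real.sqrt 2 - y := sub_pos.2 hlt
  have hc : 0 ≤ y / (1 + Real.sqrt 2 - y) := div_nonneg hy.le hgap.le
  have h1 : stripByLim T y - stripGFy T L (IsBetaDart T) y ≤ y / (1 + Real.sqrt 2 - y) * stripGFy T L (IsEpsDart L) y := by
    rw [sub_le_iff_le_add]
    refine ciSup_le fun L' => ?_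
    rcases le_total L L' with h | h
    · linarith [stripGFy_beta_sub_le hT hy hlt h]
    · have := stripGFy_beta_mono_L (T := T) h hy.le
      have hE : 0 ≤ y / (1 + Real.sqrt 2 - y) * stripGFy T L (IsEpsDart L) y :=
        mul_nonneg hc (stripGFy_nonneg' T L (IsEpsDart L) hy.le)
      linarith
  refine ⟨h1, h1.trans ?_⟩
  have h2 := stripGFy_eps_le_sqrt_two_mul_pow hT hy hlt.le L
  calc y / (1 + Real.sqrt 2 - y) * stripGFy T L (IsEpsDart L) y
      ≤ y / (1 + Real.sqrt 2 - y) * (Real.sqrt 2 * (1 - hexCriticalFugacity ^ (2 * T) * (2 + Real.sqrt 2 - y)) ^ L) :=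
        mul_le_mul_of_nonneg_left h2 hc
    _ = Real.sqrt 2 * y / (1 + Real.sqrt 2 - y) * (1 - hexCriticalFugacity ^ (2 * T) * (2 + Real.sqrt 2 - y)) ^ L := by ring


/-! ### The critical arch identity at `y*` for EVERY width, unconditionally -/

/-- The defect of identity (16) at `y*` is the side class: `1 − cos(3π/8) A_{T,L}(x_c;y*) = cos(π/4) E_{T,L}(x_c;y*)` (`β(y*) = 0`).
[cite: BeatonBousquetMelouDeGierDuminilCopinGuttmann2014, §4.2 (arXiv v5 p. 14: "set y = y* in (16). Since β(y*) = 0, we obtain 1 = αA_{T,L}(x_c; y*) + εE_{T,L}(x_c; y*)")] -/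
theorem one_sub_cos_mul_stripGFy_alpha_yStar (hT : 1 ≤ T) (L : ℕ) :
    1 - Real.cos (3 * Real.pi / 8) * stripGFy T L IsAlphaDart yStar = Real.cos (Real.pi / 4) * stripGFy T L (IsEpsDart L) yStar := by
  have hid := strip_identityY (L := L) hT yStar_pos
  have hβ : (1 + Real.sqrt 2 - yStar) / (Real.sqrt 2 * yStar) = 0 := by unfold yStar; simp
  rw [hβ, zero_mul, add_zero] at hid
  linarith

/-- ★★ **The defect decays geometrically: `0 ≤ 1 − cos(3π/8) A_{T,L}(x_c; y*) ≤ (1 − x_c^{2T})^L`** for every `T ≥ 1`, `L` (`cos(π/4)·√2 = 1`).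
[cite: BeatonBousquetMelouDeGierDuminilCopinGuttmann2014, §4.2 (arXiv v5 p. 14); BeatonGuttmannJensen2012Adsorption, §2 eq. (4) (arXiv:1110.6695 p. 4: "1 = cos(3π/8) A_T(x_c, y_c)"); lane: explicit rate, no radius input] -/
theorem one_sub_cos_mul_stripGFy_alpha_yStar_mem_Icc (hT : 1 ≤ T) (L : ℕ) :
    1 - Real.cos (3 * Real.pi / 8) * stripGFy T L IsAlphaDart yStar ∈ Set.Icc (0 : ℝ) ((1 - hexCriticalFugacity ^ (2 * T)) ^ L) := by
  rw [one_sub_cos_mul_stripGFy_alpha_yStar hT L]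
  have hE := stripGFy_nonneg' T L (IsEpsDart L) yStar_pos.le
  have hc : Real.cos (Real.pi / 4) = Real.sqrt 2 / 2 := Real.cos_pi_div_four
  have hs2 : Real.sqrt 2 * Real.sqrt 2 = 2 := Real.mul_self_sqrt (by norm_num)
  have hdec := stripGFy_eps_yStar_le_pow hT L
  refine ⟨mul_nonneg (cos_pi_div_four_pos').le hE, ?_⟩
  rw [hc]
  calc Real.sqrt 2 / 2 * stripGFy T L (IsEpsDart L) yStar
      ≤ Real.sqrt 2 / 2 * (Real.sqrt 2 * (1 - hexCriticalFugacity ^ (2 * T)) ^ L) := mul_le_mul_of_nonneg_left hdec (by positivity)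
    _ = (1 - hexCriticalFugacity ^ (2 * T)) ^ L := by rw [← mul_assoc, div_mul_eq_mul_div, hs2]; ring

/-- ★★★ **`cos(3π/8) · A_T(x_c; y*) = 1` for EVERY `T ≥ 1`, UNCONDITIONALLY** — the tree's `cos_mul_stripAyLim_yStar_eq_one` without its
hypothesis `y* < y_T`: the side class at `y*` is squeezed to `0` by the geometric rate, so the identity passes to the limit.  Printed as
BGJ12-Ads eq. (4) «1 = cos(3π/8) A_T(x_c, y_c)» ("for any width T"). [cite: BeatonGuttmannJensen2012Adsorption, §2 eq. (4) (arXiv:1110.6695 p. 4); BeatonBousquetMelouDeGierDuminilCopinGuttmann2014, Proposition 9 eq. (18) at y = y* (arXiv v5 p. 14) with Theorem 2; lane: route without Corollary 8's radius clause] -/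
theorem cos_mul_stripAyLim_yStar_eq_one' (hT : 1 ≤ T) : Real.cos (3 * Real.pi / 8) * stripAyLim T yStar = 1 := by
  have hx0 := hexCriticalFugacity_pos_lt_one
  have hA := (tendsto_stripAy_yStar hT).const_mul (Real.cos (3 * Real.pi / 8))
  have hq0 : 0 ≤ 1 - hexCriticalFugacity ^ (2 * T) := sub_nonneg.2 (pow_le_one₀ hx0.1.le hx0.2.le)
  have hq1 : 1 - hexCriticalFugacity ^ (2 * T) < 1 := sub_lt_self _ (pow_pos hx0.1 _)
  have hpow : Tendsto (fun L : ℕ => (1 - hexCriticalFugacity ^ (2 * T)) ^ L) atTop (𝓝 0) :=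
    tendsto_pow_atTop_nhds_zero_of_lt_one hq0 hq1
  have hdef : Tendsto (fun L : ℕ => 1 - Real.cos (3 * Real.pi / 8) * stripGFy T L IsAlphaDart yStar) atTop (𝓝 0) :=
    squeeze_zero (fun L => (one_sub_cos_mul_stripGFy_alpha_yStar_mem_Icc hT L).1)
      (fun L => (one_sub_cos_mul_stripGFy_alpha_yStar_mem_Icc hT L).2) hpow
  have h1 : Tendsto (fun L : ℕ => Real.cos (3 * Real.pi / 8) * stripGFy T L IsAlphaDart yStar) atTop (𝓝 (1 - 0)) := by
    have := (tendsto_const_nhds (x := (1 : ℝ))).sub hdef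
    refine this.congr fun L => ?_
    ring
  rw [sub_zero] at h1
  exact tendsto_nhds_unique hA h1

/-! ### In Duminil-Copin–Smirnov's own frame (`y = 1`): the side class `E^{x_c}_{T,L}` and the arch partial sums, with rates -/

/-- `A_T(x_c; 1)` of the `y`-frame is DCS12's `A_T(x_c)` (`HV.stripAlim`). [cite: DuminilCopinSmirnov2012, §3 (A_T = lim A_{T,L})] -/
theorem stripAyLim_one (T : ℕ) : stripAyLim T 1 = stripAlim T := by
  simp only [stripAyLim, stripAlim, stripGFy_alpha_one]

/-- ★ **DCS12's side class at the critical point contracts geometrically**: `E_{T,L+1}(x_c) ≤ (1 − x_c^{2T}(1 + √2)) · E_{T,L}(x_c)`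
(`T ≥ 1`; the case `y = 1` of `stripGFy_eps_succ_le_sideDecayRate_mul`). [cite: DuminilCopinSmirnov2012, §3 (arXiv v2 p. 6, after Lemma 2 / identity (2): "(E^{x_c}_{T,L})_{L>0} decreases and converges"; Proof of Theorem 1: "decreases in L"); lane: explicit rate] -/
theorem stripE_succ_le_mul (hT : 1 ≤ T) (L : ℕ) :
    stripE T (L + 1) hexCriticalFugacity ≤ (1 - hexCriticalFugacity ^ (2 * T) * (1 + Real.sqrt 2)) * stripE T L hexCriticalFugacity := by
  have h := stripGFy_eps_succ_le_sideDecayRate_mul hT one_pos (by linarith [Real.sqrt_nonneg 2] : (1 : ℝ) ≤ 1 + Real.sqrt 2) L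
  have e : sideDecayRate T 1 = 1 - hexCriticalFugacity ^ (2 * T) * (1 + Real.sqrt 2) := by rw [sideDecayRate]; ring
  rwa [stripGFy_eps_one, stripGFy_eps_one, e] at h

/-- ★★ **`E_{T,L}(x_c) ≤ √2 · (1 − x_c^{2T}(1 + √2))^L`** — an explicit geometric rate for the tree's `stripElim_zero` / DCS12's
`E^{x_c}_{T,L} → E_T`. [cite: DuminilCopinSmirnov2012, §3 (the limits A_T, B_T, E_T exist); lane: explicit rate, E_T = 0 with a rate] -/
theorem stripE_le_sqrt_two_mul_pow (hT : 1 ≤ T) (L : ℕ) :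
    stripE T L hexCriticalFugacity ≤ Real.sqrt 2 * (1 - hexCriticalFugacity ^ (2 * T) * (1 + Real.sqrt 2)) ^ L := by
  have h := stripGFy_eps_le_sqrt_two_mul_pow hT one_pos (by linarith [Real.sqrt_nonneg 2] : (1 : ℝ) ≤ 1 + Real.sqrt 2) L
  have e : (2 : ℝ) + Real.sqrt 2 - 1 = 1 + Real.sqrt 2 := by ring
  rwa [stripGFy_eps_one, e] at h

/-- ★★ **DCS12's arch partial sums converge geometrically**: `A_T(x_c) − A_{T,L}(x_c) ≤ E_{T,L}(x_c)/x_c ≤ (√2/x_c) · (1 − x_c^{2T}(1+√2))^L`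
(`T ≥ 1`). [cite: DuminilCopinSmirnov2012, §3 (arXiv v2 p. 6: "sequences (A^x_{T,L})_{L>0} and (B^x_{T,L})_{L>0} are increasing in L and are bounded for x ≤ x_c … Thus they have limits"); lane: explicit rate] -/
theorem stripAlim_sub_stripA_le (hT : 1 ≤ T) (L : ℕ) :
    stripAlim T - stripA T L hexCriticalFugacity ≤ hexCriticalFugacity⁻¹ * stripE T L hexCriticalFugacity ∧
      stripAlim T - stripA T L hexCriticalFugacity ≤
        Real.sqrt 2 / hexCriticalFugacity * (1 - hexCriticalFugacity ^ (2 * T) * (1 + Real.sqrt 2)) ^ L := by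
  have h := stripAyLim_sub_le hT one_pos (by linarith [Real.sqrt_nonneg 2] : (1 : ℝ) ≤ 1 + Real.sqrt 2) L
  have e : (2 : ℝ) + Real.sqrt 2 - 1 = 1 + Real.sqrt 2 := by ring
  rwa [stripAyLim_one, stripGFy_alpha_one, stripGFy_eps_one, e] at h

end Literature.Probability.RandomPlanarGeometry.SAW.HV
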